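import Summits.CriticalPhenomena.PercolationContinuityZ3.Theorems.PercNearOneGluingNoHeavyLowerTailSahiCombOrderTwo
import Summits.CriticalPhenomena.PercolationContinuityZ3.Theorems.PercNearOneGluingNoHeavyLowerTailSahiCombSubstitution
import Summits.CriticalPhenomena.PercolationContinuityZ3.Theorems.PercNearOneGluingNoHeavyLowerTailSahiCoordinateBernstein
import Summits.CriticalPhenomena.PercolationContinuityZ3.Theorems.PercNearOneGluingNoHeavyLowerTailSahiC4CombBridge
import Summits.CriticalPhenomena.PercolationContinuityZ3.Theorems.PercNearOneGluingNoHeavyLowerTailLogDerivSchema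

/-!
# The comb (tensor-Bernstein) hierarchy for Sahi's `E_k`, VII: the TOP HALF of ORDER-1(3) alone implies Sahi's `C_3`
# on product measures — hence `CombOrderTwoTop 3 → MasterFamilyNonneg 3` (Kahn's Conjecture 5)

Support file of the one-cut programme (crux `NoHeavyLowerTail`, stmt-CriticalPhenomena-4575; cell `prim-bnk`, seat bnk-2 gen 7,
memo `run/shared/lean/prim/prim-l12/FROM-prim-bnk-2-g7-TOP-HALF-C3.md`; INEQ-CLAIMS rows S2-GRAPH, COMB-M-E3).  This is the
measure-level link announced but not formalised in `…SahiCombOrderTwo` (gen 6) and in prim-ineq-gen-4 g5 §II: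

**THEOREM (`masterFamilyNonneg_three_of_combLine_top_le`).**  If `c_3 ≤ c_2` holds on every coefficient line of the three-copy
comb array of every triple of increasing events on every finite cube (with a second point), then `0 ≤ E_3(μ_p; 1_{U_0},1_{U_1},1_{U_2})`
for every triple of increasing events on every finite cube and every product measure — `MasterFamilyNonneg 3`, i.e. Kahn's
Conjecture 5 (`masterFamilyNonneg_three_iff_kahnConjecture`).  COROLLARY (`masterFamilyNonneg_three_of_combOrderTwoTop`,
`kahnConjecture_of_combOrderTwoTop`): the census-clean two-dimensional law `CombOrderTwoTop 3` (ORDER-2-TOP(3); ttrl request 1058: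
`E_3` on `m ≤ 5` coordinates EXHAUSTIVE, `4.6·10¹¹` blocks, `0` violations; graph arrays `K_4`–`K_6`, sparse `n ≤ 12`: `0`) implies `C_3`.
Only the TOP end of ORDER-1 is used; the bottom inequality `c_0 ≤ c_1` (needed by the ENDMIN route of `…SahiCombShape`) is not.

PROOF (series reparametrisation + the one-sided log-derivative schema of `…LogDerivSchema`).  Induction on a determining
coordinate set.  Along a coordinate `e` the function `x ↦ Q(x) = E_3(μ_{p[e↦x]}; U)` is the cubic `sahiEP (secPoly p e) 3 1_U`
(`…SahiMasterFamilyCoordPoly`) with `Q(0), Q(1) = E_3` of the `e`-sections (induction hypothesis, `≥ 0`).  SUBSTITUTE for `e` two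
coordinates in series: on the cube `Option (Fin r)` put the blocks `X_j = {some j ∈ ω}` (`j ≠ e`), `X_e = {some e ∈ ω ∧ none ∈ ω}`
(`serBlock`; disjoint supports) and the pulled-back triple `U' = subst X U` (increasing); by `SahiCombSubstitution.sahiE_subst`,
`E_3(μ_{p'}; U') = Q(s·y)` where `s, y` are the parameters of `some e`, `none`.  Expanding `E_3(μ_{p'}; U')` in the comb basis and
splitting along the axis `none` (`sahiE_three_eq_sum_lineSum`) gives `Q(s·y) = Σ_t B_t(s) y^t (1−y)^{3−t}` with line sums `B_t`; the
hypothesis at the axis `none` gives `B_3 ≤ B_2` (`lineSum_three_le_two`), and reading the cubic in `y` at `y = 0, ⅓, ⅔, 1` gives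
`B_2 − B_3 = 2Q(s) − s·Q′(s)`.  So `2Q − sQ′ ≥ 0` on `(0,1]`, whence `Q(s) ≥ s²·Q(1) ≥ 0` (`LogDerivSchema.ge_sq_mul_of_logDeriv_nonneg'`).
(General finite `ι`: relabel, `SahiC4CombBridge.sahiE_bernoulliWeight_comap_equiv`.)  Everything here is proved; axioms
standard; Sahi's `C_3` itself and `CombOrderTwoTop 3` remain OPEN. [this work]
-/

noncomputable section

open scoped Classical

namespace Summit.CriticalPhenomena.PercolationContinuityZ3.Theorems

open Finset Function Polynomial
open Literature.Combinatorics.Sahi2008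
open Literature.Probability.LatticeModels (prodBernoulli prodBernoulli_real_setOf_mem
  prodBernoulli_real_inter_of_determinedBy_disjoint)
open Literature.Probability.Percolation (DeterminedBy determinedBy_iff)
open Literature.Probability.Percolation.DecisionTree (ind ind_of_mem ind_of_not_mem ind_nonneg)
open SahiComb SahiCombSubstitution

namespace SahiCombTopC3

/-! ### Splitting the comb expansion of `E_3` along one axis: the line sums `B_t` -/

section Split

variable {κ : Type} [Fintype κ]

/-- The off-axis weight of a profile `k` at the parameter `q`: `∏_{z ≠ a} q_z^{k_z}(1 − q_z)^{3 − k_z}`. [this work] -/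
def offWeight (a : κ) (q : κ → unitInterval) (k : κ → ℕ) : ℝ :=
  ∏ z ∈ univ.erase a, ((q z : ℝ) ^ (k z) * (1 - (q z : ℝ)) ^ (3 - k z))

/-- **The line sum** `B_t = Σ_{k : k_a = 0} c(k[a ↦ t]) · ∏_{z ≠ a} q_z^{k_z}(1−q_z)^{3−k_z}`: the `t`-th (unnormalised) Bernstein
coefficient in the variable `q_a` of `E_3(μ_q; 1_V)`, the other parameters frozen (`sahiE_three_eq_sum_lineSum`). [this work] -/
def lineSum (V : Fin 3 → Set (Set κ)) (a : κ) (q : κ → unitInterval) (t : ℕ) : ℝ :=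
  ∑ k ∈ (box (fun _ : κ => 3)).filter (fun k => k a = 0), combLine 3 V a k t * offWeight a q k

/-- Off-axis weights are `≥ 0`. [this work] -/
theorem offWeight_nonneg (a : κ) (q : κ → unitInterval) (k : κ → ℕ) : 0 ≤ offWeight a q k :=
  prod_nonneg fun z _ => mul_nonneg (pow_nonneg (q z).2.1 _) (pow_nonneg (sub_nonneg.2 (q z).2.2) _)

/-- The off-axis weight does not read the parameter at the axis. [this work] -/
theorem offWeight_update_param (a : κ) (q : κ → unitInterval) (y : unitInterval) (k : κ → ℕ) :
    offWeight a (update q a y) k = offWeight a q k :=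
  prod_congr rfl fun z hz => by rw [update_of_ne (ne_of_mem_erase hz)]

/-- The off-axis weight does not read the digit at the axis. [this work] -/
theorem offWeight_update_profile (a : κ) (q : κ → unitInterval) (k : κ → ℕ) (t : ℕ) :
    offWeight a q (update k a t) = offWeight a q k :=
  prod_congr rfl fun z hz => by rw [update_of_ne (ne_of_mem_erase hz)]

/-- The line sums do not read the parameter at the axis. [this work] -/
theorem lineSum_update_param (V : Fin 3 → Set (Set κ)) (a : κ) (q : κ → unitInterval) (y : unitInterval) (t : ℕ) :
    lineSum V a (update q a y) t = lineSum V a q t :=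
  sum_congr rfl fun k _ => by rw [offWeight_update_param]

/-- A degree-`3` basis function factors into its off-axis weight and the axis factor. [this work] -/
theorem bern_three_eq (a : κ) (q : κ → unitInterval) (j : κ → ℕ) :
    bern (fun _ : κ => 3) j q = offWeight a q j * ((q a : ℝ) ^ (j a) * (1 - (q a : ℝ)) ^ (3 - j a)) := by
  show (∏ z, ((q z : ℝ) ^ (j z) * (1 - (q z : ℝ)) ^ (3 - j z))) = _
  rw [offWeight, prod_erase_mul _ _ (mem_univ a)]

/-- **`E_3` along one axis in Bernstein form with explicit line sums**:
`E_3(μ_q; 1_V) = Σ_{t=0}^{3} B_t · q_a^t (1 − q_a)^{3−t}`. [this work] -/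
theorem sahiE_three_eq_sum_lineSum (V : Fin 3 → Set (Set κ)) (a : κ) (q : κ → unitInterval) :
    sahiE (bernoulliWeight q) 3 (fun i => ind (V i)) =
      ∑ t ∈ range 4, lineSum V a q t * ((q a : ℝ) ^ t * (1 - (q a : ℝ)) ^ (3 - t)) := by
  rw [sahiE_bernoulliWeight_eq_sum_combCoeff,
    ← sum_fiberwise_of_maps_to (s := box (fun _ : κ => 3)) (t := range 4) (g := fun j => j a)
      (fun j hj => mem_range.2 (Nat.lt_succ_of_le (mem_box.1 hj a)))]
  refine sum_congr rfl fun t ht => ?_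
  have ht3 : t ≤ 3 := Nat.lt_succ_iff.1 (mem_range.1 ht)
  rw [lineSum, sum_mul]
  refine sum_nbij' (fun j => update j a 0) (fun k => update k a t) ?_ ?_ ?_ ?_ ?_
  · intro j hj
    obtain ⟨hjb, -⟩ := mem_filter.1 hj
    refine mem_filter.2 ⟨mem_box.2 fun z => ?_, update_self a 0 j⟩
    by_cases hz : z = a
    · subst hz; rw [update_self]; exact Nat.zero_le _
    · rw [update_of_ne hz]; exact mem_box.1 hjb z
  · intro k hk
    obtain ⟨hkb, -⟩ := mem_filter.1 hk
    refine mem_filter.2 ⟨mem_box.2 fun z => ?_, update_self a t k⟩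
    by_cases hz : z = a
    · subst hz; rw [update_self]; exact ht3
    · rw [update_of_ne hz]; exact mem_box.1 hkb z
  · intro j hj
    rw [update_idem, ← (mem_filter.1 hj).2, update_eq_self]
  · intro k hk
    rw [update_idem, ← (mem_filter.1 hk).2, update_eq_self]
  · intro j hj
    obtain ⟨-, hja⟩ := mem_filter.1 hj
    rw [combLine, update_idem, offWeight_update_profile, bern_three_eq a q j, hja, update_eq_self_iff.2 hja.symm]
    ring

/-- **TOP(3) on the lines along `a` gives `B_3 ≤ B_2`.** [this work] -/
theorem lineSum_three_le_two (V : Fin 3 → Set (Set κ)) (a : κ) (q : κ → unitInterval)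
    (hV : ∀ k : κ → ℕ, combLine 3 V a k 3 ≤ combLine 3 V a k 2) : lineSum V a q 3 ≤ lineSum V a q 2 :=
  sum_le_sum fun k _ => mul_le_mul_of_nonneg_right (hV k) (offWeight_nonneg a q k)

/-- `E_3` along one axis, the four Bernstein terms written out. [this work] -/
theorem sahiE_three_eq_lineSum (V : Fin 3 → Set (Set κ)) (a : κ) (q : κ → unitInterval) :
    sahiE (bernoulliWeight q) 3 (fun i => ind (V i)) =
      lineSum V a q 0 * (1 - (q a : ℝ)) ^ 3 + lineSum V a q 1 * ((q a : ℝ) * (1 - (q a : ℝ)) ^ 2)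
        + lineSum V a q 2 * ((q a : ℝ) ^ 2 * (1 - (q a : ℝ))) + lineSum V a q 3 * (q a : ℝ) ^ 3 := by
  rw [sahiE_three_eq_sum_lineSum V a q]
  simp only [sum_range_succ, sum_range_zero]
  norm_num

end Split

/-- A polynomial of degree `≤ 3` evaluated through its four coefficients. [folklore] -/
theorem cubic_eval_eq {Q : ℝ[X]} (hQ : Q.natDegree ≤ 3) (x : ℝ) :
    Q.eval x = Q.coeff 0 + Q.coeff 1 * x + Q.coeff 2 * x ^ 2 + Q.coeff 3 * x ^ 3 := by
  conv_lhs => rw [Q.as_sum_range_C_mul_X_pow' (show Q.natDegree < 4 by omega)]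
  simp only [Finset.sum_range_succ, Finset.sum_range_zero, eval_add, eval_mul, eval_C, eval_pow, eval_X, zero_add]
  ring

/-! ### The series substitution: one coordinate replaced by two coordinates in series -/

section Series

-- decidability on `Fin r`, `Option (Fin r)` is classical here, as in the generic-`ι` lemmas we rewrite with (`update`, `erase`)
attribute [local instance 1001] Classical.propDecidable

variable {r : ℕ}

/-- **The series blocks** on the cube `Option (Fin r)`: `X_j = {some j ∈ ω}` for `j ≠ e` and `X_e = {some e ∈ ω ∧ none ∈ ω}`
(the coordinate `e` is open iff BOTH `some e` and the new point `none` are open). [this work] -/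
def serBlock (e j : Fin r) : Set (Set (Option (Fin r))) :=
  if j = e then {ω | some e ∈ ω ∧ none ∈ ω} else {ω | some j ∈ ω}

/-- The supports of the series blocks: `{some e, none}` resp. `{some j}`. [this work] -/
def serSupp (e j : Fin r) : Finset (Option (Fin r)) :=
  if j = e then {some e, none} else {some j}

/-- The series blocks are increasing events. [this work] -/
theorem isUpperSet_serBlock (e j : Fin r) : IsUpperSet (serBlock e j) := by
  unfold serBlock
  split_ifs
  · exact fun _ _ hle h => ⟨hle h.1, hle h.2⟩
  · exact fun _ _ hle h => hle h

/-- The supports of the series blocks are pairwise disjoint. [this work] -/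
theorem serSupp_pairwiseDisjoint (e : Fin r) : (Set.univ : Set (Fin r)).PairwiseDisjoint (serSupp e) := by
  intro i _ j _ hij
  rw [Function.onFun, Finset.disjoint_left]
  intro z hzi hzj
  unfold serSupp at hzi hzj
  split_ifs at hzi hzj with hi hj hj
  · exact hij (hi.trans hj.symm)
  · simp only [Finset.mem_insert, Finset.mem_singleton] at hzi hzj
    rcases hzi with rfl | rfl
    · exact hj (Option.some_injective _ hzj).symm
    · exact Option.some_ne_none _ hzj.symm
  · simp only [Finset.mem_insert, Finset.mem_singleton] at hzi hzj
    rcases hzj with rfl | rfl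
    · exact hi (Option.some_injective _ hzi).symm
    · exact Option.some_ne_none _ hzi.symm
  · simp only [Finset.mem_singleton] at hzi hzj
    exact hij (Option.some_injective _ (hzi.symm.trans hzj))

/-- A one-point cylinder is determined by that point. [folklore] -/
theorem determinedBy_mem_singleton {α : Type*} (x : α) :
    DeterminedBy {ω : Set α | x ∈ ω} (↑({x} : Finset α) : Set α) := by
  rw [determinedBy_iff]
  intro ω ω' h
  have hx := Set.ext_iff.1 h x
  simp only [Set.mem_inter_iff, Finset.coe_singleton, Set.mem_singleton_iff, and_true] at hx
  exact hx

/-- Each series block is determined by its support. [this work] -/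
theorem determinedBy_serBlock (e j : Fin r) : DeterminedBy (serBlock e j) (↑(serSupp e j) : Set (Option (Fin r))) := by
  unfold serBlock serSupp
  split_ifs with hj
  · rw [determinedBy_iff]
    intro ω ω' h
    have h1 := Set.ext_iff.1 h (some e)
    have h2 := Set.ext_iff.1 h none
    simp only [Set.mem_inter_iff, Finset.coe_insert, Finset.coe_singleton, Set.mem_insert_iff,
      Set.mem_singleton_iff, true_or, or_true, and_true] at h1 h2
    simp only [Set.mem_setOf_eq, h1, h2]
  · exact determinedBy_mem_singleton (some j)

/-- **The base parameter on the big cube**: `p` on the old points (`s` at `some e`), `0` at the new point `none` (the value at `none`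
is always overwritten by `update · none y`). [this work] -/
def serBase (p : Fin r → unitInterval) (e : Fin r) (σ : unitInterval) : Option (Fin r) → unitInterval :=
  fun z => z.elim 0 fun j => if j = e then σ else p j

/-- **The block parameters of the series blocks**: `μ_{p'}(X_j) = p_j` (`j ≠ e`) and `μ_{p'}(X_e) = s·y` — the law of the bit vector
is the product measure with `p_e` replaced by `s·y`. [this work] -/
theorem blockParam_serBase (p : Fin r → unitInterval) (e : Fin r) (σ y : unitInterval) :
    blockParam (update (serBase p e σ) none y) (serBlock e) = update p e (σ * y) := by
  funext j
  apply Subtype.ext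
  simp only [blockParam]
  rw [ex_bernoulliWeight_ind]
  by_cases hj : j = e
  · subst hj
    rw [update_self, Set.Icc.coe_mul]
    have hsplit : serBlock j j = {ω : Set (Option (Fin r)) | some j ∈ ω} ∩ {ω | none ∈ ω} := by
      unfold serBlock; rw [if_pos rfl]; rfl
    have hsb : serBase p j σ (some j) = σ := by simp [serBase]
    rw [hsplit, prodBernoulli_real_inter_of_determinedBy_disjoint _ (F := {some j}) (F' := {none})
      (Finset.disjoint_singleton.2 (Option.some_ne_none j)) (determinedBy_mem_singleton _)
      (determinedBy_mem_singleton _) MeasurableSet.of_discrete MeasurableSet.of_discrete,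
      prodBernoulli_real_setOf_mem, prodBernoulli_real_setOf_mem, update_of_ne (Option.some_ne_none j), update_self, hsb]
  · rw [update_of_ne hj]
    have hblk : serBlock e j = {ω : Set (Option (Fin r)) | some j ∈ ω} := by
      unfold serBlock; rw [if_neg hj]
    have hsb : serBase p e σ (some j) = p j := by simp [serBase, hj]
    rw [hblk, prodBernoulli_real_setOf_mem, update_of_ne (Option.some_ne_none j), hsb]

/-- **Series substitution leaves `E_3` unchanged up to the reparametrisation `p_e = s·y`.** [this work] -/
theorem sahiE_serSubst (p : Fin r → unitInterval) (e : Fin r) (σ y : unitInterval) (U : Fin 3 → Set (Set (Fin r))) :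
    sahiE (bernoulliWeight (update (serBase p e σ) none y)) 3 (fun i => ind (subst (serBlock e) (U i))) =
      sahiE (bernoulliWeight (update p e (σ * y))) 3 (fun i => ind (U i)) := by
  rw [sahiE_subst _ (serBlock e) (serSupp e) (serSupp_pairwiseDisjoint e) (determinedBy_serBlock e) 3 U,
    blockParam_serBase]

/-- **The key inequality** (TOP(3) on the substituted cube ⟹ the one-sided log-derivative condition at every interior
parameter): with `Q = sahiEP (secPoly p e) 3 1_U = Σ c_i X^i` the fibre cubic of `E_3` along `e`,
`0 ≤ 2c_0 + c_1 s − c_3 s^3 (= 2Q(s) − sQ′(s))` for every `s ∈ [0,1]`. [this work] -/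
theorem logDeriv_form_nonneg
    (hTop : ∀ (κ : Type) [Fintype κ] (V : Fin 3 → Set (Set κ)), (∀ i, IsUpperSet (V i)) →
      ∀ (a b : κ), a ≠ b → ∀ k : κ → ℕ, combLine 3 V a k 3 ≤ combLine 3 V a k 2)
    (p : Fin r → unitInterval) (e : Fin r) (U : Fin 3 → Set (Set (Fin r))) (hU : ∀ i, IsUpperSet (U i))
    (σ : unitInterval) :
    0 ≤ 2 * (sahiEP (secPoly p e) 3 (fun i => ind (U i))).coeff 0
        + (sahiEP (secPoly p e) 3 (fun i => ind (U i))).coeff 1 * (σ : ℝ)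
        - (sahiEP (secPoly p e) 3 (fun i => ind (U i))).coeff 3 * (σ : ℝ) ^ 3 := by
  have hU' : ∀ i, IsUpperSet (subst (serBlock e) (U i)) :=
    fun i => isUpperSet_subst (fun j => isUpperSet_serBlock e j) (hU i)
  have hB : lineSum (fun i => subst (serBlock e) (U i)) none (serBase p e σ) 3 ≤
      lineSum (fun i => subst (serBlock e) (U i)) none (serBase p e σ) 2 :=
    lineSum_three_le_two _ none _ fun k =>
      hTop (Option (Fin r)) _ hU' none (some e) (Option.some_ne_none e).symm k
  have hrep := cubic_eval_eq (natDegree_sahiEP_le (secPoly p e) (natDegree_secPoly_le p e) 3 (fun i => ind (U i)))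
  -- the fibre cubic at `s·y` is the Bernstein cubic in `y` with the line sums of the substituted triple
  have hval : ∀ y : ℝ, 0 ≤ y → y ≤ 1 →
      (sahiEP (secPoly p e) 3 (fun i => ind (U i))).coeff 0
        + (sahiEP (secPoly p e) 3 (fun i => ind (U i))).coeff 1 * ((σ : ℝ) * y)
        + (sahiEP (secPoly p e) 3 (fun i => ind (U i))).coeff 2 * ((σ : ℝ) * y) ^ 2
        + (sahiEP (secPoly p e) 3 (fun i => ind (U i))).coeff 3 * ((σ : ℝ) * y) ^ 3 =
      lineSum (fun i => subst (serBlock e) (U i)) none (serBase p e σ) 0 * (1 - y) ^ 3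
        + lineSum (fun i => subst (serBlock e) (U i)) none (serBase p e σ) 1 * (y * (1 - y) ^ 2)
        + lineSum (fun i => subst (serBlock e) (U i)) none (serBase p e σ) 2 * (y ^ 2 * (1 - y))
        + lineSum (fun i => subst (serBlock e) (U i)) none (serBase p e σ) 3 * y ^ 3 := by
    intro y hy0 hy1
    have h3 := sahiE_three_eq_lineSum (fun i => subst (serBlock e) (U i)) none
      (update (serBase p e σ) none ⟨y, hy0, hy1⟩)
    rw [lineSum_update_param, lineSum_update_param, lineSum_update_param, lineSum_update_param, update_self,
      sahiE_serSubst, sahiE_update_eq_eval, Set.Icc.coe_mul, hrep] at h3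
    exact h3
  have e0 := hval 0 le_rfl zero_le_one
  have e13 := hval (1 / 3) (by norm_num) (by norm_num)
  have e23 := hval (2 / 3) (by norm_num) (by norm_num)
  have e1 := hval 1 zero_le_one le_rfl
  have key : 2 * (sahiEP (secPoly p e) 3 (fun i => ind (U i))).coeff 0
        + (sahiEP (secPoly p e) 3 (fun i => ind (U i))).coeff 1 * (σ : ℝ)
        - (sahiEP (secPoly p e) 3 (fun i => ind (U i))).coeff 3 * (σ : ℝ) ^ 3 =
      lineSum (fun i => subst (serBlock e) (U i)) none (serBase p e σ) 2
        - lineSum (fun i => subst (serBlock e) (U i)) none (serBase p e σ) 3 := by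
    linear_combination e0 - (9 / 2 : ℝ) * e13 + 9 * e23 - (7 / 2 : ℝ) * e1
  linarith [key]

/-- **The induction on a determining set** (cube `Fin r`): under TOP(3), every triple of increasing events determined by `S`
has `E_3(μ_p) ≥ 0` for every product measure `p`.  Step at `e`: the `e`-sections are determined by `S ∖ {e}` (induction: the
end values `Q(0), Q(1) ≥ 0`), `logDeriv_form_nonneg` gives `2Q − sQ′ ≥ 0` on `(0,1]`, and the ODE comparison
`LogDerivSchema.ge_sq_mul_of_logDeriv_nonneg'` gives `Q(s) ≥ s²Q(1) ≥ 0`. [this work] -/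
theorem sahiE_three_nonneg_of_determinedBy
    (hTop : ∀ (κ : Type) [Fintype κ] (V : Fin 3 → Set (Set κ)), (∀ i, IsUpperSet (V i)) →
      ∀ (a b : κ), a ≠ b → ∀ k : κ → ℕ, combLine 3 V a k 3 ≤ combLine 3 V a k 2)
    (S : Finset (Fin r)) :
    ∀ (U : Fin 3 → Set (Set (Fin r))), (∀ i, IsUpperSet (U i)) → (∀ i, DeterminedBy (U i) (↑S : Set (Fin r))) →
      ∀ p : Fin r → unitInterval, 0 ≤ sahiE (bernoulliWeight p) 3 (fun i => ind (U i)) := by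
  induction S using Finset.induction_on with
  | empty =>
    intro U _ hUd p
    rw [sahiE_bernoulliWeight_eq_sum_combCoeff]
    exact sum_nonneg fun j _ => mul_nonneg
      (combCoeff_ind_nonneg_of_trivial U (fun i => eq_empty_or_univ_of_determinedBy_empty (hUd i)) j) (bern_nonneg _ _ _)
  | insert e S heS ih =>
    intro U hU hUd p
    have hsec : ∀ (b : Bool) (i : Fin 3), DeterminedBy (secAt e b (U i)) (↑S : Set (Fin r)) := fun b i => by
      simpa only [erase_insert heS] using determinedBy_secAt e b (hUd i)
    have hend : ∀ b : Bool, 0 ≤ (sahiEP (secPoly p e) 3 (fun i => ind (U i))).eval ((boolParam b : unitInterval) : ℝ) := by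
      intro b
      rw [SahiCoordinateBernstein.eval_fibre_boolParam p e b U]
      exact ih _ (fun i => isUpperSet_secAt e b (hU i)) (hsec b) p
    have h0 : 0 ≤ (sahiEP (secPoly p e) 3 (fun i => ind (U i))).eval 0 := by
      have hb : ((boolParam false : unitInterval) : ℝ) = 0 := by simp [boolParam]
      simpa only [hb] using hend false
    have h1 : 0 ≤ (sahiEP (secPoly p e) 3 (fun i => ind (U i))).eval 1 := by
      have hb : ((boolParam true : unitInterval) : ℝ) = 1 := by simp [boolParam]
      simpa only [hb] using hend true
    have hrep := cubic_eval_eq (natDegree_sahiEP_le (secPoly p e) (natDegree_secPoly_le p e) 3 (fun i => ind (U i)))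
    -- the coefficient form of the cubic, as a function on `ℝ`
    set c₀ := (sahiEP (secPoly p e) 3 (fun i => ind (U i))).coeff 0 with hc₀
    set c₁ := (sahiEP (secPoly p e) 3 (fun i => ind (U i))).coeff 1 with hc₁
    set c₂ := (sahiEP (secPoly p e) 3 (fun i => ind (U i))).coeff 2 with hc₂
    set c₃ := (sahiEP (secPoly p e) 3 (fun i => ind (U i))).coeff 3 with hc₃
    have hfd : Differentiable ℝ (fun x : ℝ => c₀ + c₁ * x + c₂ * x ^ 2 + c₃ * x ^ 3) :=
      fun x => (LogDerivSchema.cubic_hasDerivAt c₀ c₁ c₂ c₃ x).differentiableAt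
    have hM : ∀ x ∈ Set.Ioc (0 : ℝ) 1, 0 ≤ 2 * (fun x : ℝ => c₀ + c₁ * x + c₂ * x ^ 2 + c₃ * x ^ 3) x
        - x * deriv (fun x : ℝ => c₀ + c₁ * x + c₂ * x ^ 2 + c₃ * x ^ 3) x := by
      intro x hx
      rw [(LogDerivSchema.cubic_hasDerivAt c₀ c₁ c₂ c₃ x).deriv]
      have key := logDeriv_form_nonneg hTop p e U hU ⟨x, hx.1.le, hx.2⟩
      rw [← hc₀, ← hc₁, ← hc₃] at key
      have hring : 2 * (c₀ + c₁ * x + c₂ * x ^ 2 + c₃ * x ^ 3) - x * (c₁ + 2 * c₂ * x + 3 * c₃ * x ^ 2)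
          = 2 * c₀ + c₁ * x - c₃ * x ^ 3 := by ring
      show 0 ≤ 2 * (c₀ + c₁ * x + c₂ * x ^ 2 + c₃ * x ^ 3) - x * (c₁ + 2 * c₂ * x + 3 * c₃ * x ^ 2)
      rw [hring]
      exact key
    have hmain := LogDerivSchema.ge_sq_mul_of_logDeriv_nonneg' hfd hM
    -- the end values in coefficient form
    have hf0 : 0 ≤ c₀ := by rw [hrep] at h0; simpa using h0
    have hf1 : 0 ≤ c₀ + c₁ * 1 + c₂ * 1 ^ 2 + c₃ * 1 ^ 3 := by rwa [hrep] at h1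
    -- evaluate at `x = p e`
    have hE : sahiE (bernoulliWeight p) 3 (fun i => ind (U i)) =
        (sahiEP (secPoly p e) 3 (fun i => ind (U i))).eval (p e : ℝ) := by
      have h := sahiE_update_eq_eval p e (p e) 3 (fun i => ind (U i))
      rwa [update_eq_self] at h
    rw [hE, hrep]
    rcases (p e).2.1.eq_or_lt with h0e | hpos
    · rw [← h0e]
      simpa using hf0
    · exact le_trans (mul_nonneg (sq_nonneg _) hf1) (hmain _ ⟨hpos, (p e).2.2⟩)

end Series

end SahiCombTopC3

open SahiCombTopC3

/-- **THE TOP HALF OF ORDER-1(3) IMPLIES SAHI'S `C_3` ON PRODUCT MEASURES.**  If `c_3 ≤ c_2` on every coefficient line of the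
three-copy comb array of every triple of increasing events on every finite cube with a second point `b ≠ a` (the conclusion
shape of `combLine_three_top_le_of_orderTwoTop`), then `MasterFamilyNonneg 3`: `0 ≤ E_3(μ_p; 1_{U_0},1_{U_1},1_{U_2})` for all
increasing events on every finite cube and every `p` (Kahn's Conjecture 5 on product measures,
`masterFamilyNonneg_three_iff_kahnConjecture`).  Proof: series reparametrisation + one-sided log-derivative schema
(file docstring); the bottom inequality `c_0 ≤ c_1` is NOT used. [this work] -/
theorem masterFamilyNonneg_three_of_combLine_top_le
    (hTop : ∀ (κ : Type) [Fintype κ] (V : Fin 3 → Set (Set κ)), (∀ i, IsUpperSet (V i)) →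
      ∀ (a b : κ), a ≠ b → ∀ k : κ → ℕ, combLine 3 V a k 3 ≤ combLine 3 V a k 2) :
    MasterFamilyNonneg 3 := by
  intro ι _ p U hU
  obtain ⟨φ⟩ : Nonempty (ι ≃ Fin (Fintype.card ι)) := ⟨Fintype.equivFin ι⟩
  have hU' : ∀ j, IsUpperSet (ThreePartition.comapFam φ.symm (U j)) :=
    fun j => SahiC4CombBridge.isUpperSet_comapFam φ (hU j)
  rw [← SahiC4CombBridge.sahiE_bernoulliWeight_comap_equiv φ p 3 U]
  exact sahiE_three_nonneg_of_determinedBy hTop Finset.univ _ hU' (fun j => determinedBy_coe_univ _) _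

/-- **ORDER-2-TOP(3) ⟹ Sahi's `C_3` on product measures**: the census-clean two-dimensional law `CombOrderTwoTop 3`
(`Δ⁺_eΔ⁺_f c ≥ 0`, `Δ⁺_eΔ⁻_f c ≥ 0`; ttrl request 1058: `m ≤ 5` exhaustive, `0` violations) implies `MasterFamilyNonneg 3`, through
`combLine_three_top_le_of_orderTwoTop` (gen 6) and `masterFamilyNonneg_three_of_combLine_top_le`. [this work] -/
theorem masterFamilyNonneg_three_of_combOrderTwoTop (h : CombOrderTwoTop 3) : MasterFamilyNonneg 3 :=
  masterFamilyNonneg_three_of_combLine_top_le fun _ _ V hV a b hab k =>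
    combLine_three_top_le_of_orderTwoTop h V hV a b hab k

/-- **ORDER-2-TOP(3) ⟹ Kahn's Conjecture 5** (three increasing events under a product measure have `E_3 ≥ 0`). [this work] -/
theorem kahnConjecture_of_combOrderTwoTop (h : CombOrderTwoTop 3) : KahnConjecture :=
  masterFamilyNonneg_three_iff_kahnConjecture.1 (masterFamilyNonneg_three_of_combOrderTwoTop h)

/-- **ORDER-2-TOP(3) ⟹ `C_3` for DECREASING triples** (the percolation separation rows are down-sets; order duality). [this work] -/
theorem masterFamilyNonnegLower_three_of_combOrderTwoTop (h : CombOrderTwoTop 3) : MasterFamilyNonnegLower 3 :=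
  (masterFamilyNonnegLower_iff 3).2 (masterFamilyNonneg_three_of_combOrderTwoTop h)

end Summit.CriticalPhenomena.PercolationContinuityZ3.Theorems
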